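import Mathlib
import HarnessLib
import HarnessLib.Audit
import Summits.KontsevichZagierPeriods.Statement
import Literature.NumberTheory.Transcendental.KZProductIdeal

/-!
Route: MellinExponentDeformation

CLOSED (retired) 2026-08-15T13:48:35Z by operator:999:1257524 — reason: not-a-thesis: assembly does not conclude the sub-problem Statement — note: D-0027 §2.1 audit (human 2026-08-15: routes that do not decide the summit are removed): the assembly concludes `GaussFibreKZ`, not the sub-problem statement; a NEW conforming route may be opened from the same idea (generated `closes : … → _root_.KontsevichZagierPeriods`).. The file is kept as the record of this route; refuted decls are indexed as negative knowledge (`ledger negatives`).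

# Route MellinExponentDeformation — Deform the exponent — IBP with radical certificates is
Conjecture 1 along exponent cosets; the Euler–Gauss family as the first rank-two sector

Realises card mellin-exponent-deformation-ibp. Organise rational KZ representations into MELLIN
FAMILIES s ↦ [σ, A·∏ g_k^{s_k}] (A, g_k ∈ ℚ[x], g_k > 0 on σ, s_k ∈ ℚ): inside a family the calculus
of moves has a distinguished, complete-at-generic-exponent sub-calculus — integration by parts with
RADICAL certificates A·∏ g_k^{p_k/q_k} (semialgebraic, hence admissible primitives for rule 3; this
is where "algebraic functions" in Conjecture 1 come from), which at generic exponents generates ALL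
relations (twisted de Rham / parametric-annihilator completeness: AomotoKita2011 §4.3.1,
BitounEtAl2018 Cor. 18). It suffices, for Conjecture 1 restricted to one exponent coset (exponents
congruent mod ℤ) of one family, to show X = X1 ∧ X2 ∧ X3: (X1, MasterReduction) every member of the
coset is tied to a fixed basis of "master" members by KZ moves (IBP + additivity, integer
coefficients); (X2, MasterIrrational) the master values at the rational fibre are ℤ-linearly
independent — the WHOLE transcendence content of the sector, one statement; (X3, TorsionFree)
FormalRep ⧸ relations has no torsion (provable: scale integrands by 1/N). Typed here for the first
family of rank two, the Euler–Gauss family E(a,b,c;z) = [ (0,1), t^{b−1}(1−t)^{c−b−1}(1−zt)^{−a} ]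
(a,b,c,z ∈ ℚ, 0<b<c, z<1, z≠0, non-resonant a,b,c−a,c−b ∉ ℤ, infinite monodromy), whose masters are
E and its z-derivative E(a+1,b+1,c+1;z): target GaussFibreKZ = "two members of one coset with the
same value are KZ-equivalent". The engine is typed for every dimension (BoxIBPTransfer). X is a
SECTOR of the summit (pairs inside one coset); cross-coset and cross-family relations (dilations =
Kummer/Fermat coverings, reflection, CM correspondences) are deliberately left to the sibling cards
terasoma-covering-gauss-multiplication, correspondences-as-multivalued-cov,
compiling-substitutions-unfolded-angles; the conjectural bridge "ker eval is generated by
within-coset relations plus covering/CM relations" (card H5) is recorded, not filed.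
Lean:
`Summit.KontsevichZagierPeriods.KontsevichZagierPeriods.Theses.MellinExponentDeformation.GaussFibreKZ`
i.e. `∀ (a b c z : ℚ), 0 < b → b < c → z < 1 → z ≠ 0 → (∀ n : ℤ, a ≠ n ∧ b ≠ n ∧ c - a ≠ n ∧ c - b ≠
n) → (∃ k : ℕ, Nat.Coprime k (Nat.lcm (Nat.lcm a.den b.den) c.den) ∧ (Int.fract ((k : ℚ) * a) <
Int.fract ((k : ℚ) * c) ↔ Int.fract ((k : ℚ) * b) < Int.fract ((k : ℚ) * c))) → ∀ (i j k i' j' k' :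
ℤ) (κ κ' : ℚ) (r r' : Literature.NumberTheory.Transcendental.KZ.IntegralRep 1), … r.value = r'.value
→ Literature.NumberTheory.Transcendental.KZ.Equivalent r r'` (full term in item 0; elaborated in
Sketch.lean, rc 0)

## Assembly
Pure algebra plus the PROVED soundness
`Literature.NumberTheory.Transcendental.KZ.relations_le_ker_eval_holds`: given coset members r, r'
with equal value, GaussMasterReduction gives N[r] ≡ P[r₀]+Q[r₁] and N'[r'] ≡ P'[r₀]+Q'[r₁]; applying
eval, (N'P−NP')·v₀ + (N'Q−NQ')·v₁ = 0, and GaussMasterIrrational (Irrational (v₀/v₁), which also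
forces v₁ ≠ 0) kills both coefficients; hence NN'·([r]−[r']) ∈ relations and TorsionFree concludes.
BoxIBPTransfer is the intended engine of GaussMasterReduction (n = 1) and is carried as the first
antecedent so the assembly records the whole mechanism; logically it is not used. The conclusion is
the route TARGET (a sector of the summit), not the summit: the bridge to `KontsevichZagierPeriods`
is the card's conjectural H5 (every c ∈ ker eval is a sum of within-coset relations of Mellin
families and covering/CM relations), GPC-strength and owned jointly with the correspondence cards —
deliberately not filed as an item.

Rationale: WHY THIS LINE. Every other line on this summit deforms the GEOMETRY (a parameter in the domain or
integrand: AyoubSpecialisation, gauss-manin-rational-certificates) or widens the calculus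
(ExpConservative); this one deforms the EXPONENT, where a completeness theorem already exists on the
other side of an explicit dictionary with perturbative QFT / twisted de Rham theory: Feynman family
↦ Mellin family, IBP/shift relation with coefficients polynomial in the exponents ↦ ℚ[s]-relation
among members, parametric annihilator P·g^s = 0 ↦ Stokes move with certificate polynomial × g^s,
master integrals ↦ basis of the fibre module; Bitoun–Bogner–Klausen–Panzer prove the Mellin
transform is a bijection between annihilating shift operators and parametric annihilators and that
the number of masters is an Euler characteristic (BitounEtAl2018 Lemma 7, Cor. 14, Cor. 18, §3,
after Loeser–Sabbah), and Aomoto–Kita give the same at generic exponents with reduction certificates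
rational in the exponents (AomotoKita2011 §4.3.1, eqs. (4.184)–(4.187), Remark 2.5). Specialising at
a RATIONAL exponent p/q lands on g^{p/q}, a ℚ-semialgebraic function, so every such relation is an
instance of rule 3 with an algebraic primitive — no limit, no transcendental primitive (the barrier
noSemialgebraicPrimitive corresponds to ∂/∂s, i.e. g^s·log g, which is never taken). What the
transplant leaves over at a rational fibre is exactly the ℤ-linear relations among the finitely many
master VALUES — periods of the cyclic cover y^q = g^p — so Conjecture 1 on a coset splits cleanly
into a move-theoretic part (reduction, provable) and ONE transcendence statement; for the
Euler–Gauss family the latter is "period and quasi-period of the hypergeometric curve over the same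
cycle are ℤ-independent", in the range of the analytic subgroup theorem (Wolfart1988;
BakerWustholz2007 §8.5; HuberWustholz2022 Ch. 19 and Thm 15.3; Masser1975 for (1/2,1/2,1)). Sibling
route HermiteRigidity (opened today, card reduction-rigidity-one-motivic-sectors) runs the same
REDUCTION + RIGIDITY schema at FIXED exponent 1/2 in the polynomial direction (Hermite reduction of
∫P dx/√f, genus 1–2, Masser rigidity); this route reduces in the EXPONENT direction (contiguity =
IBP with radical certificates), which reaches the hypergeometric curves y^N = t^A(1−t)^B(1−zt)^C of
every genus and CM by ℚ(ζ_N) with one engine and is the direction in which completeness is a theorem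
at generic parameters; the common Legendre coset (1/2,1/2,1) is left to HermiteRigidity as
calibration. Imported areas: D-module/IBP technology from Feynman-integral calculus (reduction
algorithms become move generators), transcendence of 1-periods. Negatives index: empty at filing.

RANKED CRUXES. #0 GaussFibreKZ (target) — Conjecture 1 on one exponent coset of the Euler–Gauss
family: for rational a,b,c,z with 0<b<c, z<1, z≠0, a,b,c−a,c−b ∉ ℤ (irreducible) and infinite
monodromy (Beukers–Heckman: some k coprime to the common denominator for which {ka},{kb} do NOT
interlace with {0},{kc}), any two members κ·E(a+i,b+j,c+k;z), κ'·E(a+i',b+j',c+k';z) (integer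
shifts, rational scalings, both absolutely convergent) with the same value are KZ-equivalent. (why
it might fail: it is Conjecture 1 for this family: true iff the coset's value relations are all
contiguity relations, i.e. iff GaussMasterIrrational holds at (a,b,c,z); a CM fibre of an arithmetic
triangle group with an unexpected period/quasi-period relation would break it.)
[KontsevichZagier2001, AomotoKita2011, BitounEtAl2018, BeukersHeckman1989, Wolfart1988]
#2 GaussMasterIrrational (crux) — The transcendence input of the sector, isolated: under the
hypotheses of the target, the two master values E(a,b,c;z) = ∫₀¹ t^{b−1}(1−t)^{c−b−1}(1−zt)^{−a}dt
and E(a+1,b+1,c+1;z) = ∫₀¹ t^{b}(1−t)^{c−b−1}(1−zt)^{−a−1}dt (= E′(z)/a) have IRRATIONAL ratio.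
Equivalently zE′/E ∉ ℚ: the period and the quasi-period of the eigen-differential ω_χ on the curve
y^N = t^{A}(1−t)^{B}(1−zt)^{C} over the same (Pochhammer) cycle are ℤ-independent. Expected from
Wüstholz's analytic subgroup theorem applied to the hypergeometric abelian variety A(a,b,c;z)
(dimension φ(N), End ⊇ ℤ[ζ_N]): at a non-CM fibre all entries of a χ-block of the period matrix are
ℚ̄-independent (dimension formula), at a CM fibre the relation would force the Kodaira–Spencer class
of ω_χ to vanish, which the non-vanishing Wronskian forbids; finite monodromy (excluded) is exactly
where it fails. [difficulty: open-problem] (why it might fail: The reduction to the analytic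
subgroup theorem needs the χ-isotypic part of Jac(y^N=…) to be simple with End⁰ = ℚ(ζ_N) off CM
points; extra automorphisms for special (a,b,c) may split it and allow a rational
period/quasi-period ratio at some rational z.) [Wolfart1988, BakerWustholz2007, HuberWustholz2022,
BeukersHeckman1989, Masser1975, Literature.NumberTheory.Transcendental.masser_ellipticPeriods]
#3 GaussMasterReduction (crux) — Laporta/contiguity reduction INSIDE the calculus: for rational
a,b,c,z with 0<b<c, z<1, z≠0 and a,b,c−a,c−b ∉ ℤ there exist the two master representations r₀ =
E(a,b,c;z), r₁ = E(a+1,b+1,c+1;z) on (0,1), and every absolutely convergent coset member r =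
κ·E(a+i,b+j,c+k;z) satisfies N·[r] − P·[r₀] − Q·[r₁] ∈ KZ.relations for some integers N ≠ 0, P, Q.
Proof plan: Gauss's contiguous relations are integrand algebra (rule 1b) plus ONE integration by
parts in t with primitive t^{β}(1−t)^{γ}(1−zt)^{δ} (rational exponents: a radical certificate, rule
3 via BoxIBPTransfer with n = 1); non-resonance makes every unit shift an isomorphism of the rank-2
contiguity module over ℚ[z,1/z,1/(1−z)] (AomotoKita2011 §4.3.1), so monotone lattice paths inside
the convex convergence region {b+j>0, c+k−b−j>0} reduce any member to {r₀,r₁} with non-vanishing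
pivots; rational coefficients are placed inside integrands, integers outside. [deps: BoxIBPTransfer]
[difficulty: XL] (why it might fail: Each 3-term relation used must involve only CONVERGENT members
with non-zero pivot at the rational point; near the walls 0<b<1, 0<c−b<1 the classical Gauss
relations pass through divergent neighbours, and the IBP primitives with exponents in (0,1) must
still be fibrewise continuous on [0,1].) [AomotoKita2011, AndrewsAskeyRoy1999, BitounEtAl2018,
KontsevichZagier2001, Literature.NumberTheory.Transcendental.KZ.newtonLeibnizRel]
#4 BoxIBPTransfer (crux) — The transplanted IBP move, any dimension n, any direction i, RADICAL
certificates: on the open unit box let F = A·∏_k g_k^{s_k} with A, g_k ∈ ℚ[x₁…x_n], g_k > 0 on the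
open box, s_k ∈ ℚ; if F tends to 0 at both ends of every fibre in direction i, then the
representation [ (0,1)^n, ∂_iF ] (∂_iF = (∂_iA + A·Σ_k s_k ∂_ig_k/g_k)·∏ g_k^{s_k}, absolute
integrability being part of the datum) is a KZ relation. This is Bitoun–Bogner–Klausen–Panzer's
"differentiation rule" of the Mellin transform (Lemma 7; boundary terms vanish) turned into moves:
reindex so that i is last (KZ.IntegralRep.reindex, proved), one Newton–Leibniz move on the band
(0,1)^{n−1} × [0,1] with the ℚ-semialgebraic primitive F extended by 0 on the two faces (continuous
on closed fibres by hypothesis, derivative ∂_iF inside), base representation [(0,1)^{n−1}, 0] ∈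
relations, faces null (rule 1a). Every parametric-annihilator / contiguity relation specialised at a
rational exponent in the convergence region is a ℤ-combination of such instances and rule 1b. Dep on
a sibling route: GaussManinCertificates.KZStokesBox (stmt-KontsevichZagierPeriods-3015, abstract
primitive H, last coordinate, rational-certificate line) is the natural lemma underneath; what THIS
item adds and tests is the admissibility of RADICAL certificates (ℚ-semialgebraicity of A·∏g_k^{s_k}
extended by 0 to the closed box, fibrewise continuity from the limit hypotheses) and arbitrary
direction i. [difficulty: L] (why it might fail: newtonLeibnizRel wants the primitive
ℚ-semialgebraic on the CLOSED band and continuous on each closed fibre: the extension of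
A·∏g_k^{s_k} by 0 to faces where some g_k vanishes with s_k<0 is semialgebraic, but fibrewise limits
alone may not give the IsSemialgebraicFunOn witness the move needs.) [BitounEtAl2018,
KontsevichZagier2001, Literature.NumberTheory.Transcendental.KZ.newtonLeibnizRel,
Literature.NumberTheory.Transcendental.KZ.IntegralRep.of_sub_of_reindex_mem_relations]
#9 TorsionFree (support) — FormalRep ⧸ KZ.relations is torsion-free: N·c ∈ relations with N ≠ 0
forces c ∈ relations. Proof (provable now): the endomorphism φ_N [σ,f] := [σ, f/N] maps each of the
four move sets into itself, and c − N·φ_N(c) ∈ relations by iterated integrand additivity; so N·c ∈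
rel ⇒ N·φ_N(c) = φ_N(N·c) ∈ rel ⇒ c ∈ rel. Needed to divide the integer coefficients produced by
GaussMasterReduction; same lemma as D0 of card kz-coaction-devissage = item
stmt-KontsevichZagierPeriods-3169 of route CoactionDevissage (signature copied verbatim so the item
is SHARED) and L0 of card integral-domain-roots-of-identities. [difficulty: provable-now]
[KontsevichZagier2001, Literature.NumberTheory.Transcendental.KZ.integrandAddRel]
#9 BetaCosetKZ (support) — Calibration, rank one, UNCONDITIONAL: Conjecture 1 holds on every
exponent coset of the Beta family — two representations κ·[ (0,1), x^{a+i−1}(1−x)^{b+j−1} ], κ'·[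
(0,1), x^{a+i'−1}(1−x)^{b+j'−1} ] (a,b ∈ ℚ, integer shifts, rational scalings) with equal value are
KZ-equivalent. All values in a coset are positive rational multiples of one Beta value (translation
relations B(a+1,b) = a/(a+b)·B(a,b) = one IBP with primitive x^a(1−x)^b plus rule 1b), so equality
of values is equality of rational factors and the chain of moves exists; first completeness theorem
for a family with infinitely many members, and the "T" generator of the Rohrlich–Lang trichotomy
(Waldschmidt2006; Deligne1982HodgeCycles §7) realised as moves. Sibling: LowDimension 0118 (one
dilation instance). [difficulty: M] [AndrewsAskeyRoy1999, Waldschmidt2006, KontsevichZagier2001]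

TWO-LAYER PLAN. GaussMasterReduction ⇐ (ContiguityAtoms: the five unit-shift relations a→a±1,
(b,c)→(b+1,c+1), c→c+1 and their inverses as KZ relations among three convergent members, via
BoxIBPTransfer n=1) → (PathReduction: composition along monotone lattice paths with non-vanishing
pivots under non-resonance) → GaussMasterReduction. GaussMasterIrrational ⇐ (LegendreCase:
(a,b,c)=(1/2,1/2,1) from `Literature.NumberTheory.Transcendental.masser_ellipticPeriods` + the CM
list of rational λ — shared calibration with HermiteRigidity.RealEllipticSectorKernel,
stmt-KontsevichZagierPeriods-3410) → (GeneralCase: hypergeometric abelian variety, needs the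
1-period vocabulary shared with LowDimension 0510) → GaussMasterIrrational. BoxIBPTransfer ⇐
(LastCoordinate: i = last, one newtonLeibnizRel instance + null faces) → (Reindex:
`of_sub_of_reindex_mem_relations`) → BoxIBPTransfer.

KILL CRITERIA. A refutation of GaussMasterIrrational at some (a,b,c,z) in scope (a rational
period/quasi-period ratio) does not kill the line but REDIRECTS it: it exhibits a value relation
inside a coset that is not a contiguity relation — by the thesis it must be a covering/CM relation,
and the pair becomes the sharpest test item for the correspondence routes; the target is then
restated with that fibre excluded. A refutation of BoxIBPTransfer (an IBP identity with radical
certificate that is NOT in KZ.relations although both sides converge) kills the route outright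
(close --reason refuted:BoxIBPTransfer) and hands route Neg an explicit candidate pair. A refutation
of GaussMasterReduction with BoxIBPTransfer proved means the convergence-region path argument is
wrong: pivot to reduction with masters chosen deeper inside the region (restate), not a close. Proof
of GaussFibreKZ by other means moots nothing (the cruxes are the content).

NOT DECOMPOSED YET. Resonant cosets (a, b, c−a or c−b ∈ ℤ: reducible monodromy, the Beta sub-sector
and incomplete-Beta members — BetaCosetKZ covers the pure Beta family only); finite-monodromy
(Schwarz-list) cosets, where in-coset value relations of covering type DO occur at special z — these
belong to the dilation/covering generator (cards terasoma-covering-gauss-multiplication,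
correspondences-as-multivalued-cov, two-route-hypergeometric-transport); z = 0 (pure Beta) and z ≥
1; cross-coset relations inside the family (algebraic transformations, Gauss summation at z = 1,
reflection) and cross-family relations; general Mellin families in dimension ≥ 2 (Appell–Lauricella,
Aomoto–Gelfand, Lee–Pomeransky polynomials of Feynman graphs: #masters = Euler characteristic,
BitounEtAl2018 §3) — only the engine BoxIBPTransfer is filed in that generality; the orthant version
(half-infinite fibres need a compactifying change of variables first); the general structural claim
H5 of the card (MellinLifting) and its resonance analysis (b-function roots; #masters jumps at
integer fibres, BitounEtAl2018 §3 remark after Thm (L–S)).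

CHEAPEST FALSIFIER. (i) GaussMasterIrrational: 60-digit values of E(a,b,c;z) and E(a+1,b+1,c+1;z)
for a handful of in-scope parameters, e.g. (a,b,c,z) = (1/3,1/2,5/4,1/2), (1/4,1/3,7/6,−1),
(1/2,1/2,1,1/3), and a continued-fraction / PSLQ test of the ratio against rationals of height ≤
10^12 — one rational hit refutes the crux at that fibre (kit pari, minutes; not run from this
compute-free seat). (ii) GaussMasterReduction: a symbolic check (any CAS with contiguous relations)
that E(a,b,c+1;z) and E(a−1,b,c;z) reduce to {E(a,b,c), E(a+1,b+1,c+1)} through CONVERGENT members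
only when 0 < c−b < 1, e.g. (1/3,1/2,3/4,1/2). (iii) BoxIBPTransfer, smallest instance: n=1, K=2,
g=(x,1−x), s=(1/2,1/2), A=1: is [ (0,1), (1−2x)/(2√(x(1−x))) ] ∈ KZ.relations by ONE
newtonLeibnizRel move with F = √(x(1−x)) (the very example of KZ2001 §1.1)? If the Lean side
conditions refuse it, the engine is mis-stated.

NUMBERS. Context only: the Neg/ExpConservative test pair B(1/9,4/9)·B(5/9,7/9) = 2·3^{7/6}·π ≈
22.6371 is a CROSS-coset (dilation + reflection) relation of the Beta family and is out of this
route's sector by design; its pure-dilation form is (1/3)·B(1/9,4/9)B(5/9,7/9) = 3^{2/3}·B(1/3,2/3)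
(terasoma card). In-sector example: E(1/2,1/2,1;λ) = 2K(√λ)-type complete elliptic integral,
E(3/2,3/2,2;λ) its λ-derivative ×2; ratio irrational for every rational λ ∈ (0,1) by Masser1975
(non-CM and CM).

DEFINITION REQUESTS. None filed at open. Foreseen (tenure, only if GaussMasterReduction closes):
`MellinFamily` / fibre-module vocabulary under
Summits/KontsevichZagierPeriods/KontsevichZagierPeriods/Theorems to state H5 (MellinLifting) and the
general MasterReduction; the 1-period vocabulary for GaussMasterIrrational is the pending request of
LowDimension 0510 (HuberWustholzOnePeriods, interim form landed as
Literature/NumberTheory/Transcendental/OnePeriods.lean).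

Novelty: Searches (2026-08-15): `lit search --hybrid "Kontsevich Zagier period conjecture integration by
parts master integrals Feynman"` (10 docs: KZ2001, HuberWustholz2022, Marcolli Feynman Motives,
amplitude textbooks — none links IBP reduction to Conjecture 1); `lit search --hybrid "contiguous
relations hypergeometric integration by parts twisted cohomology"` (Haraoka 2020, Kedlaya 2022,
AomotoKita2011 held); `lit search --hybrid "transcendence values hypergeometric functions monodromy
Wolfart Wüstholz abelian varieties"` (Baker1975, BakerWustholz2007 §8.5 read pp.143–146,
HuberWustholz2022 Ch.19 read pp.181–184, Chudnovsky1984, Nesterenko–Philippon); `lit read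
arxiv:1712.09215` (BitounEtAl2018: Lemma 7, Cor. 14, Cor. 18, §3 read); `lit read book:aomoto2011…
--grep contiguity|Euler characteristic` (§4.3.1 p.240 read); `lit galaxy search … --star all` ×4 (0
rows; galaxyd saturated, logged); ledger: 123 cards; the 6 legacy routes and the 14 routes opened
today on this sub read by decl (TorsionFree shared with CoactionDevissage 3169; KZStokesBox 3015 of
GaussManinCertificates and HermiteRigidity's fixed-exponent reduction+rigidity noted as nearest
in-tree neighbours); negatives index empty; plain `lit search` FTS tier down (connection reset) —
hybrid used throughout.
Nearest prior art found: BitounEtAl2018 (doi:10.1007/s11005-018-1114-8, arXiv:1712.09215) Cor. 18 —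
Mellin transform = bijection between annihilating shift operators and parametric annihilators,
#masters = Euler characte  [refs: 10.1007/s11005-018-1114-8, 10.1007/978-4-431-53938-4, 1712.09215, arxiv:1712.09215, book:aomoto2011, doi:10.1007/s11005-018-1114-8, doi:10.1007/978-4-431-53938-4, HuberWustholz2022, AomotoKita2011, Baker1975, BakerWustholz2007, Chudnovsky1984, BitounEtAl2018, Wolfart1988]

Barriers (technique_class: mellin-exponent-deformation, ibp-radical-certificates): - technique_class: mellin-exponent-deformation, ibp-radical-certificates
- Literature.Barriers.KontsevichZagierPeriods.noSemialgebraicPrimitive_inv_sub_two: evaded by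
construction — the only primitives used are A·∏g_k^{p_k/q_k}, ℚ-semialgebraic; the barrier's
log(2−t) is ∂/∂s of g^s at s=0 (g = 2−t), and the line never differentiates in the exponent, it
specialises polynomial-in-s identities; no variable is "integrated out" with a chosen primitive
(BoxIBPTransfer goes from a given certificate to a relation, not from a relation to a certificate).
- Literature.Barriers.KontsevichZagierPeriods.kzConjecture_implies_oddZetaAlgIndep: respected by
scope — the route proves Conjecture 1 only on exponent cosets and isolates the transcendence content
of each coset as an explicit crux (GaussMasterIrrational), which for the Gauss family lies in the
range of the analytic subgroup theorem (1-periods), not in the ζ-value range; no claim on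
cross-family relations where ζ(odd) lives (simplex/MZV families have resonant integer exponents and
are out of sector).
- Literature.Barriers.KontsevichZagierPeriods.kzConjecture_implies_twoPiI_log_algIndep: same — the
sector's values are hypergeometric 1-periods at one fibre; the needed independence (period vs
quasi-period) is Wüstholz-type and stated as a crux, not assumed silently.
- Literature.Barriers.KontsevichZagierPeriods.kzConjecture_implies_ellipticPeriods_algIndep: the
Legendre sub-family (1/2,1/2,1) needs exactly ℤ-independence of ω₁ and η₁-typ

History (route lifecycle, newest last):
- 2026-08-15T13:48:35Z · CLOSED retired — not-a-thesis: assembly does not conclude the sub-problem Statement (operator:999:1257524)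

sub-problem: KontsevichZagierPeriods · status: closed(retired) · opened planner-plancard-KontsevichZagierPeriods-Kont-98e2b8a5-0 2026-08-15T11:23:17Z · rev 0 · ledger route-KontsevichZagierPeriods-MellinExponentDeformation
GENERATED by the gate from the ledger (D-0016/17). Provers cite these decls: `theorem foo : Summit.KontsevichZagierPeriods.KontsevichZagierPeriods.Theses.MellinExponentDeformation.<Decl> := …` in Summits/KontsevichZagierPeriods/KontsevichZagierPeriods/Theorems/<Name>.lean.
-/

namespace Summit.KontsevichZagierPeriods.KontsevichZagierPeriods.Theses.MellinExponentDeformation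

open scoped BigOperators Topology Manifold Classical MeasureTheory ProbabilityTheory Matrix InnerProductSpace ComplexConjugate ContinuousMap
open Filter Set Function TopologicalSpace MeasureTheory

attribute [summit_statement] _root_.KontsevichZagierPeriods

open Literature Periods

/-- item stmt-KontsevichZagierPeriods-3718 · target · rank 0 · closed · moot by None · by planner
why it might fail: it is Conjecture 1 for this family: true iff the coset's value relations are all contiguity relations, i.e. iff GaussMasterIrrational holds at (a,b,c,z); a CM fibre of an arithmetic triangle group with an unexpected period/quasi-period relation would break it.
sources: KontsevichZagier2001, AomotoKita2011, BitounEtAl2018, BeukersHeckman1989, Wolfart1988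
[target] Conjecture 1 on one exponent coset of the Euler–Gauss family: for rational a,b,c,z with
0<b<c, z<1, z≠0, a,b,c−a,c−b ∉ ℤ (irreducible) and infinite monodromy (Beukers–Heckman: some k
coprime to the common denominator for which {ka},{kb} do NOT interlace with {0},{kc}), any two
members κ·E(a+i,b+j,c+k;z), κ'·E(a+i',b+j',c+k';z) (integer shifts, rational scalings, both
absolutely convergent) with the same value are KZ-equivalent. -/
@[route_item "route-KontsevichZagierPeriods-MellinExponentDeformation"]
def GaussFibreKZ : Prop :=
  ∀ (a b c z : ℚ), 0 < b → b < c → z < 1 → z ≠ 0 → (∀ n : ℤ, a ≠ n ∧ b ≠ n ∧ c - a ≠ n ∧ c - b ≠ n) → (∃ k : ℕ, Nat.Coprime k (Nat.lcm (Nat.lcm a.den b.den) c.den) ∧ (Int.fract ((k : ℚ) * a) < Int.fract ((k : ℚ) * c) ↔ Int.fract ((k : ℚ) * b) < Int.fract ((k : ℚ) * c))) → ∀ (i j k i' j' k' : ℤ) (κ κ' : ℚ) (r r' : Literature.NumberTheory.Transcendental.KZ.IntegralRep 1), r.domain = {x | x 0 ∈ Set.Ioo (0:ℝ) 1} → Set.EqOn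 r.integrand (fun x => (κ : ℝ) * (x 0) ^ ((b : ℝ) + j - 1) * (1 - x 0) ^ ((c : ℝ) + k - b - j - 1) * (1 - (z : ℝ) * x 0) ^ (-((a : ℝ) + i))) r.domain → r'.domain = {x | x 0 ∈ Set.Ioo (0:ℝ) 1} → Set.EqOn r'.integrand (fun x => (κ' : ℝ) * (x 0) ^ ((b : ℝ) + j' - 1) * (1 - x 0) ^ ((c : ℝ) + k' - b - j' - 1) * (1 - (z : ℝ) * x 0) ^ (-((a : ℝ) + i'))) r'.domain → r.value = r'.value → Literature.NumberTheory.Transcendental.KZ.Equivalent r r'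

/-- item stmt-KontsevichZagierPeriods-3719 · crux · rank 2 · closed · moot by None · by planner
why it might fail: The reduction to the analytic subgroup theorem needs the χ-isotypic part of Jac(y^N=…) to be simple with End⁰ = ℚ(ζ_N) off CM points; extra automorphisms for special (a,b,c) may split it and allow a rational period/quasi-period ratio at some rational z.
sources: Wolfart1988, BakerWustholz2007, HuberWustholz2022, BeukersHeckman1989, Masser1975, Literature.NumberTheory.Transcendental.masser_ellipticPeriods
[crux] The transcendence input of the sector, isolated: under the hypotheses of the target, the two
master values E(a,b,c;z) = ∫₀¹ t^{b−1}(1−t)^{c−b−1}(1−zt)^{−a}dt and E(a+1,b+1,c+1;z) = ∫₀¹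
t^{b}(1−t)^{c−b−1}(1−zt)^{−a−1}dt (= E′(z)/a) have IRRATIONAL ratio. Equivalently zE′/E ∉ ℚ: the
period and the quasi-period of the eigen-differential ω_χ on the curve y^N =
t^{A}(1−t)^{B}(1−zt)^{C} over the same (Pochhammer) cycle are ℤ-independent. Expected from
Wüstholz's analytic subgroup theorem applied to the hypergeometric abelian variety A(a,b,c;z)
(dimension φ(N), End ⊇ ℤ[ζ_N]): at a non-CM fibre all entries of a χ-block of the period matrix are
ℚ̄-independent (dimension formula), at a CM fibre the relation would force the Kodaira–Spencer class
of ω_χ to vanish, which the non-vanishing Wronskian forbids; finite monodromy (excluded) is exactly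
where it fails. [difficulty: open-problem] -/
@[route_item "route-KontsevichZagierPeriods-MellinExponentDeformation"]
def GaussMasterIrrational : Prop :=
  ∀ (a b c z : ℚ), 0 < b → b < c → z < 1 → z ≠ 0 → (∀ n : ℤ, a ≠ n ∧ b ≠ n ∧ c - a ≠ n ∧ c - b ≠ n) → (∃ k : ℕ, Nat.Coprime k (Nat.lcm (Nat.lcm a.den b.den) c.den) ∧ (Int.fract ((k : ℚ) * a) < Int.fract ((k : ℚ) * c) ↔ Int.fract ((k : ℚ) * b) < Int.fract ((k : ℚ) * c))) → ∀ (r₀ r₁ : Literature.NumberTheory.Transcendental.KZ.IntegralRep 1), r₀.domain = {x | x 0 ∈ Set.Ioo (0:ℝ) 1} → Set.EqOn r₀.integrand (fun x => (x 0) ^ ((b : ℝ) - 1) * (1 - x 0) ^ ((c : ℝ) - b - 1) * (1 - (z : ℝ) * x 0) ^ (-(a : ℝ))) r₀.domain → r₁.domain = {x | x 0 ∈ Set.Ioo (0:ℝ) 1} → Set.EqOn r₁.integrand (fun x => (x 0) ^ (b : ℝ) * (1 - x 0) ^ ((c : ℝ) - b - 1) * (1 - (z : ℝ) * x 0) ^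 (-((a : ℝ) + 1))) r₁.domain → Irrational (r₀.value / r₁.value)

/-- item stmt-KontsevichZagierPeriods-3720 · crux · rank 3 · closed · moot by None · by planner
why it might fail: Each 3-term relation used must involve only CONVERGENT members with non-zero pivot at the rational point; near the walls 0<b<1, 0<c−b<1 the classical Gauss relations pass through divergent neighbours, and the IBP primitives with exponents in (0,1) must still be fibrewise continuous on [0,1].
sources: AomotoKita2011, AndrewsAskeyRoy1999, BitounEtAl2018, KontsevichZagier2001, Literature.NumberTheory.Transcendental.KZ.newtonLeibnizRel
[crux] Laporta/contiguity reduction INSIDE the calculus: for rational a,b,c,z with 0<b<c, z<1, z≠0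
and a,b,c−a,c−b ∉ ℤ there exist the two master representations r₀ = E(a,b,c;z), r₁ =
E(a+1,b+1,c+1;z) on (0,1), and every absolutely convergent coset member r = κ·E(a+i,b+j,c+k;z)
satisfies N·[r] − P·[r₀] − Q·[r₁] ∈ KZ.relations for some integers N ≠ 0, P, Q. Proof plan: Gauss's
contiguous relations are integrand algebra (rule 1b) plus ONE integration by parts in t with
primitive t^{β}(1−t)^{γ}(1−zt)^{δ} (rational exponents: a radical certificate, rule 3 via
BoxIBPTransfer with n = 1); non-resonance makes every unit shift an isomorphism of the rank-2
contiguity module over ℚ[z,1/z,1/(1−z)] (AomotoKita2011 §4.3.1), so monotone lattice paths inside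
the convex convergence region {b+j>0, c+k−b−j>0} reduce any member to {r₀,r₁} with non-vanishing
pivots; rational coefficients are placed inside integrands, integers outside. [deps: BoxIBPTransfer]
[difficulty: XL] -/
@[route_item "route-KontsevichZagierPeriods-MellinExponentDeformation"]
def GaussMasterReduction : Prop :=
  ∀ (a b c z : ℚ), 0 < b → b < c → z < 1 → z ≠ 0 → (∀ n : ℤ, a ≠ n ∧ b ≠ n ∧ c - a ≠ n ∧ c - b ≠ n) → ∃ (r₀ r₁ : Literature.NumberTheory.Transcendental.KZ.IntegralRep 1), r₀.domain = {x | x 0 ∈ Set.Ioo (0:ℝ) 1} ∧ Set.EqOn r₀.integrand (fun x => (x 0) ^ ((b : ℝ) - 1) * (1 - x 0) ^ ((c : ℝ) - b - 1) * (1 - (z : ℝ) * x 0) ^ (-(a : ℝ))) r₀.domain ∧ r₁.domain = {x | x 0 ∈ Set.Ioo (0:ℝ) 1} ∧ Set.EqOn r₁.integrand (fun x => (x 0) ^ (b : ℝ) * (1 - x 0) ^ ((c : ℝ) - b - 1) * (1 - (z : ℝ) * x 0) ^ (-((a : ℝ) + 1))) r₁.domain ∧ ∀ (i j k : ℤ)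 (κ : ℚ) (r : Literature.NumberTheory.Transcendental.KZ.IntegralRep 1), r.domain = {x | x 0 ∈ Set.Ioo (0:ℝ) 1} → Set.EqOn r.integrand (fun x => (κ : ℝ) * (x 0) ^ ((b : ℝ) + j - 1) * (1 - x 0) ^ ((c : ℝ) + k - b - j - 1) * (1 - (z : ℝ) * x 0) ^ (-((a : ℝ) + i))) r.domain → ∃ (N P Q : ℤ), N ≠ 0 ∧ N • Literature.NumberTheory.Transcendental.KZ.of r - P • Literature.NumberTheory.Transcendental.KZ.of r₀ - Q • Literature.NumberTheory.Transcendental.KZ.of r₁ ∈ Literature.NumberTheory.Transcendental.KZ.relations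

/-- item stmt-KontsevichZagierPeriods-3721 · crux · rank 4 · closed · moot by None · by planner
why it might fail: newtonLeibnizRel wants the primitive ℚ-semialgebraic on the CLOSED band and continuous on each closed fibre: the extension of A·∏g_k^{s_k} by 0 to faces where some g_k vanishes with s_k<0 is semialgebraic, but fibrewise limits alone may not give the IsSemialgebraicFunOn witness the move needs.
sources: BitounEtAl2018, KontsevichZagier2001, Literature.NumberTheory.Transcendental.KZ.newtonLeibnizRel, Literature.NumberTheory.Transcendental.KZ.IntegralRep.of_sub_of_reindex_mem_relations
[crux] The transplanted IBP move, any dimension n, any direction i, RADICAL certificates: on the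
open unit box let F = A·∏_k g_k^{s_k} with A, g_k ∈ ℚ[x₁…x_n], g_k > 0 on the open box, s_k ∈ ℚ; if
F tends to 0 at both ends of every fibre in direction i, then the representation [ (0,1)^n, ∂_iF ]
(∂_iF = (∂_iA + A·Σ_k s_k ∂_ig_k/g_k)·∏ g_k^{s_k}, absolute integrability being part of the datum)
is a KZ relation. This is Bitoun–Bogner–Klausen–Panzer's "differentiation rule" of the Mellin
transform (Lemma 7; boundary terms vanish) turned into moves: reindex so that i is last
(KZ.IntegralRep.reindex, proved), one Newton–Leibniz move on the band (0,1)^{n−1} × [0,1] with the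
ℚ-semialgebraic primitive F extended by 0 on the two faces (continuous on closed fibres by
hypothesis, derivative ∂_iF inside), base representation [(0,1)^{n−1}, 0] ∈ relations, faces null
(rule 1a). Every parametric-annihilator / contiguity relation specialised at a rational exponent in
the convergence region is a ℤ-combination of such instances and rule 1b. Dep on a sibling route:
GaussManinCertificates.KZStokesBox (stmt-KontsevichZagierPeriods-3015, abstract primitive H, last
coordinate, rational-certificate line) i -/
@[route_item "route-KontsevichZagierPeriods-MellinExponentDeformation"]
def BoxIBPTransfer : Prop :=
  ∀ (n K : ℕ) (i : Fin n) (g : Fin K → MvPolynomial (Fin n) ℚ) (s : Fin K → ℚ) (A : MvPolynomial (Fin n) ℚ), (∀ x : Fin n → ℝ, (∀ j, x j ∈ Set.Ioo (0:ℝ) 1) → ∀ k, 0 < MvPolynomial.aeval x (g k)) → (∀ x : Fin n → ℝ, (∀ j, x j ∈ Set.Ioo (0:ℝ) 1) → Filter.Tendsto (fun t : ℝ => MvPolynomial.aeval (Function.update x i t) A * ∏ k, (MvPolynomial.aeval (Function.update x i t) (g k)) ^ ((s k : ℚ) : ℝ)) (nhdsWithin 0 (Set.Ioi 0)) (nhds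 0) ∧ Filter.Tendsto (fun t : ℝ => MvPolynomial.aeval (Function.update x i t) A * ∏ k, (MvPolynomial.aeval (Function.update x i t) (g k)) ^ ((s k : ℚ) : ℝ)) (nhdsWithin 1 (Set.Iio 1)) (nhds 0)) → ∀ (r : Literature.NumberTheory.Transcendental.KZ.IntegralRep n), r.domain = {x | ∀ j, x j ∈ Set.Ioo (0:ℝ) 1} → Set.EqOn r.integrand (fun x => (MvPolynomial.aeval x (MvPolynomial.pderiv i A) + MvPolynomial.aeval x A * ∑ k, ((s k : ℚ) : ℝ) * MvPolynomial.aeval x (MvPolynomial.pderiv i (g k)) / MvPolynomial.aeval x (g k)) * ∏ k, (MvPolynomial.aeval x (g k)) ^ ((s k : ℚ) : ℝ)) r.domain → Literature.NumberTheory.Transcendental.KZ.of r ∈ Literature.NumberTheory.Transcendental.KZ.relations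

/-- item stmt-KontsevichZagierPeriods-3169 · support · rank 9 · closed · proved by Summit.KontsevichZagierPeriods.CoactionDevissage.TorsionFree.exceptionalCouplings_torsionFree_proof @ f648441f8c8f (prover) · by planner
sources: KontsevichZagier2001, Literature.NumberTheory.Transcendental.KZ.integrandAddRel
[support] P_KZ is torsion-free: n ≠ 0, n • c ∈ KZ.relations ⇒ c ∈ KZ.relations. Proof: c − c·[0,1] ∈
relations (Newton–Leibniz on each generator r with base r, band r.domain × [0,1] = (r.prod
I₀₁).domain, F(x,t) = t·f(x)); c·[0,1] − n • (c·[0,1/n]) ∈ relations (domain additivity into n slabs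
over the null overlaps r.domain × {k/n}, translations t ↦ t − k/n as changes of variables); n •
(c·[0,1/n]) = (n • c)·[0,1/n] ∈ relations by `KZ.mul_mem_relations_right_holds`. Card item D0.
[difficulty: provable-now] -/
@[route_item "route-KontsevichZagierPeriods-MellinExponentDeformation"]
def TorsionFree : Prop :=
  ∀ (n : ℕ) (c : Literature.NumberTheory.Transcendental.KZ.FormalRep), n ≠ 0 → n • c ∈ Literature.NumberTheory.Transcendental.KZ.relations → c ∈ Literature.NumberTheory.Transcendental.KZ.relations

/-- item stmt-KontsevichZagierPeriods-3722 · support · rank 9 · closed · moot by None · by planner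
sources: AndrewsAskeyRoy1999, Waldschmidt2006, KontsevichZagier2001
[support] Calibration, rank one, UNCONDITIONAL: Conjecture 1 holds on every exponent coset of the
Beta family — two representations κ·[ (0,1), x^{a+i−1}(1−x)^{b+j−1} ], κ'·[ (0,1),
x^{a+i'−1}(1−x)^{b+j'−1} ] (a,b ∈ ℚ, integer shifts, rational scalings) with equal value are
KZ-equivalent. All values in a coset are positive rational multiples of one Beta value (translation
relations B(a+1,b) = a/(a+b)·B(a,b) = one IBP with primitive x^a(1−x)^b plus rule 1b), so equality
of values is equality of rational factors and the chain of moves exists; first completeness theorem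
for a family with infinitely many members, and the "T" generator of the Rohrlich–Lang trichotomy
(Waldschmidt2006; Deligne1982HodgeCycles §7) realised as moves. Sibling: LowDimension 0118 (one
dilation instance). [difficulty: M] -/
@[route_item "route-KontsevichZagierPeriods-MellinExponentDeformation"]
def BetaCosetKZ : Prop :=
  ∀ (a b : ℚ) (i j i' j' : ℤ) (κ κ' : ℚ) (r r' : Literature.NumberTheory.Transcendental.KZ.IntegralRep 1), r.domain = {x | x 0 ∈ Set.Ioo (0:ℝ) 1} → Set.EqOn r.integrand (fun x => (κ : ℝ) * (x 0) ^ ((a : ℝ) + i - 1) * (1 - x 0) ^ ((b : ℝ) + j - 1)) r.domain → r'.domain = {x | x 0 ∈ Set.Ioo (0:ℝ) 1} → Set.EqOn r'.integrand (fun x => (κ' : ℝ) * (x 0) ^ ((a : ℝ) + i' - 1) * (1 - x 0) ^ ((b : ℝ) + j' - 1)) r'.domain → r.value = r'.value → Literature.NumberTheory.Transcendental.KZ.Equivalent r r'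

/-- item stmt-KontsevichZagierPeriods-3723 · assembly · rank 1 · closed · moot by None · by planner
sources: KontsevichZagier2001, Literature.NumberTheory.Transcendental.KZ.relations_le_ker_eval_holds
[assembly] BoxIBPTransfer → GaussMasterReduction → GaussMasterIrrational → TorsionFree →
GaussFibreKZ -/
@[route_item "route-KontsevichZagierPeriods-MellinExponentDeformation"]
def Assembly : Prop :=
  BoxIBPTransfer → GaussMasterReduction → GaussMasterIrrational → TorsionFree → GaussFibreKZ

end Summit.KontsevichZagierPeriods.KontsevichZagierPeriods.Theses.MellinExponentDeformation
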